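import Summits.Ventures.CertifiedArithmetic.LowPrec.GemmThetaLawGenE3M2Check1
import Summits.Ventures.CertifiedArithmetic.LowPrec.GemmThetaLawGenE3M2Check2
import Summits.Ventures.CertifiedArithmetic.LowPrec.GemmThetaLawGenE3M2Check3
import Summits.Ventures.CertifiedArithmetic.LowPrec.GemmThetaLawGenE3M2Check4
import Summits.Ventures.CertifiedArithmetic.LowPrec.GemmThetaLawGenE3M2Check5
import Summits.Ventures.CertifiedArithmetic.LowPrec.GemmThetaLawGenE3M2Check6
import Summits.Ventures.CertifiedArithmetic.LowPrec.GemmThetaLawGenE3M2Check7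
import Summits.Ventures.CertifiedArithmetic.LowPrec.GemmThetaLawGenE3M2Check8
import Summits.Ventures.CertifiedArithmetic.LowPrec.GemmThetaLawGenE3M2Check9
import Summits.Ventures.CertifiedArithmetic.LowPrec.GemmThetaLawGenE3M2Check10
import Summits.Ventures.CertifiedArithmetic.LowPrec.GemmThetaLawGenE3M2Check11

/-!
# The E3M2×E3M2 law check passes for every `p ≥ 18`

HONEST FRAMING (venture CertifiedArithmetic / cell `pub-lowprec`, seat gemm, gen 13): certified
error envelopes and provably optimal rounding/accumulation schemes for low-precision formats under
stated cost models; every table by two implementations; no hardware or vendor claims.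

`lawCheck_e3m2`: the letter-dependent symbolic θ-certificate check of the E3M2×E3M2 law
(`GemmThetaLawGenE3M2Data.e3m2Law`: `J = 17`, `θ = (6149M + 12288)/65536 = 6149·2^(p-17) + 3/16`,
`ρ = 29/6`, `β_pair = 31/2`) passes — all 42,200 classes, their pair tables and all coverage
chains — assembled from the per-level kernel theorems of `GemmThetaLawGenE3M2Data.lean` and
`GemmThetaLawGenE3M2Check1..11.lean` (levels above 2400 classes from their two sign halves).
`GemmThetaLawGenE3M2Cert.lean` turns it into the θ-certificate (SUP side of t:thetap6 (E3M2 row))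
for every `p ≥ 18` by the landed soundness theorem `LawData.lawCheck_cert`. [cell]
-/

namespace Literature.ComputerArithmetic.FloatingPoint

namespace MiniFloat

namespace ThetaLaw

/-- Level `Q` of the E3M2×E3M2 law check passes (2890 classes: the two sign halves). [cell] -/
theorem levCheck_e3m2_Q : e3m2Law.levCheck Lev.Q = true := by
  unfold LawData.levCheck
  simp only [List.all_cons, List.all_nil, Bool.and_true, Bool.and_eq_true]
  exact ⟨levCheck_e3m2_Q_pos, levCheck_e3m2_Q_neg⟩

/-- Level `bin 0` of the E3M2×E3M2 law check passes (2868 classes: the two sign halves). [cell] -/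
theorem levCheck_e3m2_b0 : e3m2Law.levCheck (Lev.bin 0) = true := by
  unfold LawData.levCheck
  simp only [List.all_cons, List.all_nil, Bool.and_true, Bool.and_eq_true]
  exact ⟨levCheck_e3m2_b0_pos, levCheck_e3m2_b0_neg⟩

/-- Level `bin 1` of the E3M2×E3M2 law check passes (2830 classes: the two sign halves). [cell] -/
theorem levCheck_e3m2_b1 : e3m2Law.levCheck (Lev.bin 1) = true := by
  unfold LawData.levCheck
  simp only [List.all_cons, List.all_nil, Bool.and_true, Bool.and_eq_true]
  exact ⟨levCheck_e3m2_b1_pos, levCheck_e3m2_b1_neg⟩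

/-- Level `bin 2` of the E3M2×E3M2 law check passes (2772 classes: the two sign halves). [cell] -/
theorem levCheck_e3m2_b2 : e3m2Law.levCheck (Lev.bin 2) = true := by
  unfold LawData.levCheck
  simp only [List.all_cons, List.all_nil, Bool.and_true, Bool.and_eq_true]
  exact ⟨levCheck_e3m2_b2_pos, levCheck_e3m2_b2_neg⟩

/-- Level `bin 3` of the E3M2×E3M2 law check passes (2694 classes: the two sign halves). [cell] -/
theorem levCheck_e3m2_b3 : e3m2Law.levCheck (Lev.bin 3) = true := by
  unfold LawData.levCheck
  simp only [List.all_cons, List.all_nil, Bool.and_true, Bool.and_eq_true]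
  exact ⟨levCheck_e3m2_b3_pos, levCheck_e3m2_b3_neg⟩

/-- Level `bin 4` of the E3M2×E3M2 law check passes (2602 classes: the two sign halves). [cell] -/
theorem levCheck_e3m2_b4 : e3m2Law.levCheck (Lev.bin 4) = true := by
  unfold LawData.levCheck
  simp only [List.all_cons, List.all_nil, Bool.and_true, Bool.and_eq_true]
  exact ⟨levCheck_e3m2_b4_pos, levCheck_e3m2_b4_neg⟩

/-- Level `bin 5` of the E3M2×E3M2 law check passes (2502 classes: the two sign halves). [cell] -/
theorem levCheck_e3m2_b5 : e3m2Law.levCheck (Lev.bin 5) = true := by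
  unfold LawData.levCheck
  simp only [List.all_cons, List.all_nil, Bool.and_true, Bool.and_eq_true]
  exact ⟨levCheck_e3m2_b5_pos, levCheck_e3m2_b5_neg⟩

/-- Level `bin 6` of the E3M2×E3M2 law check passes (2402 classes: the two sign halves). [cell] -/
theorem levCheck_e3m2_b6 : e3m2Law.levCheck (Lev.bin 6) = true := by
  unfold LawData.levCheck
  simp only [List.all_cons, List.all_nil, Bool.and_true, Bool.and_eq_true]
  exact ⟨levCheck_e3m2_b6_pos, levCheck_e3m2_b6_neg⟩

/-- The levels of the E3M2×E3M2 law, explicitly. [cell] -/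
theorem levels_e3m2 : e3m2Law.levels =
    [Lev.Q, Lev.bin 0, Lev.bin 1, Lev.bin 2, Lev.bin 3, Lev.bin 4, Lev.bin 5, Lev.bin 6,
      Lev.bin 7, Lev.bin 8, Lev.bin 9, Lev.bin 10, Lev.bin 11, Lev.bin 12, Lev.bin 13,
      Lev.bin 14, Lev.bin 15, Lev.bin 16, Lev.bin 17, Lev.top] := by
  decide

/-- THE E3M2×E3M2 LAW CHECK PASSES for every `p ≥ 18`. [cell, kernel; assembled] -/
theorem lawCheck_e3m2 : e3m2Law.lawCheck = true := by
  unfold LawData.lawCheck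
  rw [levels_e3m2, sideOK_e3m2]
  simp only [List.all_cons, List.all_nil,
    levCheck_e3m2_Q, levCheck_e3m2_b0, levCheck_e3m2_b1, levCheck_e3m2_b2, levCheck_e3m2_b3,
    levCheck_e3m2_b4, levCheck_e3m2_b5, levCheck_e3m2_b6, levCheck_e3m2_b7, levCheck_e3m2_b8,
    levCheck_e3m2_b9, levCheck_e3m2_b10, levCheck_e3m2_b11, levCheck_e3m2_b12,
    levCheck_e3m2_b13, levCheck_e3m2_b14, levCheck_e3m2_b15, levCheck_e3m2_b16,
    levCheck_e3m2_b17, levCheck_e3m2_top,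
    Bool.and_self]

end ThetaLaw

end MiniFloat

end Literature.ComputerArithmetic.FloatingPoint
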